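import Summits.FinalStateConjecture.FinalStateConjecture.Theses.PhotonSphereChannels
import Summits.FinalStateConjecture.FinalStateConjecture.Theorems.PhotonSphereChannelsFixedModeReduction
import Literature.Analysis.PDE.Wave1DExteriorEnergy

/-!
# Line `matched-edge-born-tail` — skeleton for the crux `PhotonSphereChannels.UniformPhotonSphereChannelsR`
# (K1R, item stmt-FinalStateConjecture-14074, rank 2: log-ball two-ended photon-sphere channels, uniform constant)

Planner seat `cruxplan-stmt-FinalStateConjecture-14074-matched-edge-born-ta`, round 1, 2026-08-16.
Idea card `Cruxes/UniformPhotonSphereChannelsR/Ideas/matched-edge-born-tail.md` (ideator 2; passed by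
all three triagers, `TRIAGE-r1-{1,2,3}.md`: "pass — as FRAME + OUTER rung"); line card
`Lines/matched-edge-born-tail.md`.  `lean check` rc 0, sorries ONLY in the five `stub_*`;
`UniformPhotonSphereChannelsR_of` concludes the crux BY NAME from the five stub signatures with a
REAL proof: the two-ended decoupling `near log-edge channels ∧ far log-edge channels ⇒ K1R`
(`channelInequality_of_near_far`, `uniform_of_near_far`, ~250 lines, the uniform-constant version
of the landed per-mode `Theorems.fixedModeChannels_of_near_far`) is PROVED in this file, so the
stubs are exactly the one-ended statements.

## The crux (FIXED; `Theses/PhotonSphereChannels.lean`)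

`∀ M > 0, ∃ ρ₀ ≥ 0, ∃ C ≥ 0, ∃ c > 0, ∀ r xc, IsTortoiseRadius M r xc → ∀ s ≤ 2, ∀ ℓ ≥ s,
 ∀ ρ ≥ ρ₀ + C·log(ℓ+1), ChannelInequality (linePotential M s ℓ r) xc ρ c`.

## The line (one paragraph)

K1R = NEAR ∧ FAR by domain of dependence (proved here).  NEAR (`stub_nearLogEdge`) is the landed
per-mode theorem `Theorems.nearHalfLineChannels` with its constants read off uniformly
(`ρ₀(M,ℓ) = max 0 (2M log(25600 M² B e^{3/2M}))`, `B ∝ ℓ²+ℓ+1` ⇒ `C_near = 4M`, `c = 1/4`).  FAR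
(`FarLogEdgeChannels`, the open half) is cut at the COULOMB RADIUS `r ≍ ℓ M` — the card's lever:
compare `V_{s,ℓ}` on `y ≥ X` not with the centrifugal model centred at the tortoise origin but
with the model MATCHED AT THE EDGE, `ℓ(ℓ+1)/(y − X + b_X)²`, `b_X = r_X/√(1 − 2M/r_X)`; the
Coulomb logarithm then restarts at the edge (`stub_matchedEdgeBorn`: tail
`≤ 8Mℓ(ℓ+1)(1 + log(r_y/r_X))/r_y³`, zero-energy Born integral `≤ 12 Mℓ(ℓ+1)/r_X`, no `log ℓ`),
so for edges beyond the Coulomb radius (`r_X ≥ Λ₀ (ℓ+1)^a M`) the far channel inequality is a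
Born-small stationary perturbation of the exact flat identity (Côte–Laurent / KLLS, ball radius
`b_X`) with `c = 1/2`, uniformly in `ℓ` (`stub_outerBorn`, the OUTER RUNG; at fixed `ℓ` it is the
far half of `FixedModeChannels`, stmt-10048).  What is left of the log-edge far half is the INNER
ANNULUS problem (`stub_innerAnnulus`: data supported in `x_c + ρ < x`, `r(x) < (ℓ+1)^b M`; it
carries the crux's difficulty, with a frequency floor, a finite decision clock and a compact range
of scales as the genuine simplifications), and the GLUING of the two (`stub_farGluing`, the
card's Transfer: kernel invariance `E^±(d − k) = E^±(d)`, pigeonhole on `log ℓ` dyadic shells for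
the cut, non-stationary phase for the inner/outer cross terms).  `UniformPhotonSphereChannelsR_of`
composes: far := gluing (outer (matched-edge)) inner; K1R := decoupling near far.

LOAD-BEARING (the card's lever): `stub_outerBorn` (+ `stub_matchedEdgeBorn`).
HARDEST: `stub_innerAnnulus` (XL — the far log-edge channel inequality for annulus data).

## Disproof used (`Cruxes/UniformPhotonSphereChannelsR/Disproof.lean`, cdisprove v2, rc 0, sorry-free)

* The file has NO literal `_false_without_<H>` theorem; its load-bearing list (§(a), finding 5) is
  honoured stub by stub: `C > 0` (`logFree_imp_uniformR`: `C = 0` is the refuted K1,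
  `Theorems.not_UniformPhotonSphereChannels`, negatives index stmt-10045) — the log enters through
  `stub_nearLogEdge` (`C_near = 4M`) and `stub_innerAnnulus`/`stub_farGluing` (far `C`, expected
  `> 2M`); NO stub is log-free at a fixed ball: `stub_outerBorn` is log-free but its edge is
  POLYNOMIAL in `ℓ` (`r_X ≥ Λ₀(ℓ+1)^a M`), the regime the refutation analysis itself exempts
  ("then only x_f ≳ ℓ^a or per-mode survive").  `s ≤ ℓ` (positivity of `V`) is kept in every stub.
  Monotonicity (`channelsAt_mono`): the decoupling takes `ρ₀ = max`, `C = max`, `c = min`.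
* `far_frozen_channel_small` / `farAbsorption_of_uniformR` and the LANDED negative lemma
  `Theorems/UniformPhotonSphereChannelsR/Negative/FarFrozenPackets.lean` (`frozen_packet_far`,
  p82156; NOT imported — the farm reported that module "unbuilt" on 2026-08-16, and no stub has its
  shape anyway, see next sentence): far-edge rest packets have arbitrarily
  small two-ended channel energy at EVERY edge, so any far inequality must let the kernel absorb
  them.  Every far stub here keeps the `t`-polynomial kernel (`farDeficit`), none is a kernel-free
  or support-charged inequality, so no stub is an instance the lemma refutes; at the polynomial
  edges of `stub_outerBorn` absorption is the Born-perturbed flat identity (finding 3: numerically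
  RW absorbs BETTER than flat), on the annulus it is the content of `stub_innerAnnulus`.
* Finding 4(ii) (far threshold `C > 2M`, crossing scale `ω₀ ≍ ℓ e^{−x_f/2M}`) is consistent with
  the card's regime arithmetic (inner/outer methods overlap iff `ℓ^{C/2M} ≫ ℓ`).

## Triage answers (sharpenings acted on)

* r1-2/r1-3 "state OuterBornChannels with a turning-point-safe exponent and land it first": the
  exponent is existential, `a ∈ [1, 2]` (`a = 1`: Born parameter `3Mℓ/r_X`; `4/3`: Airy layer at the
  turning point; `2`: accumulation of the tower-subspace perturbation along the `⌈ℓ/2⌉`-long Jordan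
  chain, `O(ℓ · Mℓ/r_X)`), and `stub_outerBorn` is a separately landable item-sized lemma.
* r1-1/r1-2 "file the near restatement and the uniform glue once": `stub_nearLogEdge` +
  the decoupling PROVED here.
* r1-2 "InnerAnnulusChannels IS the crux restricted — declared as such": `stub_innerAnnulus`
  docstring says so; it is where the sibling lines (peel-then-wedge, mirror–Nehari) plug in.
* Constants of `stub_matchedEdgeBorn` doubled w.r.t. the card (8, 12 instead of 4, 6; measured sups
  3.80 and 4.98, `calc/matched_edge_check.py`, and 3.89 / 5.00 by r1-1, r1-2) so that a crude
  rigorous proof (`β = 1 − b′ ≤ 2.33 M/r`, `dy ≤ (3/2) dr` on `r ≥ 6M`) closes them.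
-/

set_option linter.dupNamespace false
set_option linter.unusedVariables false

noncomputable section

namespace Summit.FinalStateConjecture.FinalStateConjecture.Cruxes.UniformPhotonSphereChannelsR.MatchedEdgeBornTail

open MeasureTheory Filter Set Topology
open scoped ENNReal
open Literature.Geometry.Lorentzian Literature.Geometry.Lorentzian.ReggeWheeler
open Literature.Analysis.PDE
open Summit.FinalStateConjecture.FinalStateConjecture.Theorems
  (add_liminf_le_liminf_add_of_antitoneOn add_liminf_le_liminf_add_of_monotoneOn)

/-! ## Vocabulary: one-ended cones, kernels, deficits and channel inequalities

LEAD: these definitions are the interfaces between the stubs (the route's definition request (3),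
"`farKernel`/`farDeficit`, one-ended versions of `rwKernel`/`kernelDeficit`").  Land them FIRST as a
sorry-free Theorems file (e.g. `Theorems/UniformPhotonSphereChannelsR/OneEndedChannels.lean`, same
bodies, together with `channelInequality_of_near_far` / `uniform_of_near_far` below) so that stub
workers can import them and restate the registered `Sig.stub_*` bodies verbatim. -/

section Vocabulary

variable (V : ℝ → ℝ)

/-- The open FAR cone `{(t, x) | xe + |t| < x}` beyond the edge `xe` (towards `𝓘^±`). -/
def farCone (xe : ℝ) : Set (ℝ × ℝ) := {z | xe + |z.1| < z.2}

/-- The open NEAR cone `{(t, x) | x < xe − |t|}` below the edge `xe` (towards `𝓗^±`). -/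
def nearCone (xe : ℝ) : Set (ℝ × ℝ) := {z | z.2 < xe - |z.1|}

@[simp] theorem mem_farCone {xe : ℝ} {z : ℝ × ℝ} : z ∈ farCone xe ↔ xe + |z.1| < z.2 := Iff.rfl

@[simp] theorem mem_nearCone {xe : ℝ} {z : ℝ × ℝ} : z ∈ nearCone xe ↔ z.2 < xe - |z.1| := Iff.rfl

theorem isOpen_farCone (xe : ℝ) : IsOpen (farCone xe) :=
  isOpen_lt (by fun_prop) continuous_snd

theorem isOpen_nearCone (xe : ℝ) : IsOpen (nearCone xe) :=
  isOpen_lt continuous_snd (by fun_prop)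

/-- The FAR non-radiative kernel: `C²` solutions on the far cone that are polynomial in `t` there
(for the Regge–Wheeler potentials: the `⌊(2ℓ+5)/4⌋ + ⌊(2ℓ+3)/4⌋` finite-energy towers and their
infinite-energy companions — only finite-energy elements matter for the deficit). -/
def farKernel (xe : ℝ) : Set (ℝ → ℝ → ℝ) :=
  {p | ContDiffOn ℝ 2 (Function.uncurry p) (farCone xe) ∧
    (∀ z ∈ farCone xe, IsSolutionAt V p z) ∧ IsPolynomialInTimeOn p (farCone xe)}

/-- The NEAR non-radiative kernel (same, on the near cone). -/
def nearKernel (xe : ℝ) : Set (ℝ → ℝ → ℝ) :=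
  {p | ContDiffOn ℝ 2 (Function.uncurry p) (nearCone xe) ∧
    (∀ z ∈ nearCone xe, IsSolutionAt V p z) ∧ IsPolynomialInTimeOn p (nearCone xe)}

/-- FAR kernel deficit of `φ` at `t = 0`: `inf_{p ∈ farKernel} ∫_{x > xe} e[φ − p](0, x) dx`. -/
def farDeficit (xe : ℝ) (φ : ℝ → ℝ → ℝ) : ℝ≥0∞ :=
  ⨅ p ∈ farKernel V xe,
    ∫⁻ x in Ioi xe, ENNReal.ofReal (energyDensity V (fun t y => φ t y - p t y) 0 x)

/-- NEAR kernel deficit of `φ` at `t = 0`: `inf_{p ∈ nearKernel} ∫_{x < xe} e[φ − p](0, x) dx`. -/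
def nearDeficit (xe : ℝ) (φ : ℝ → ℝ → ℝ) : ℝ≥0∞ :=
  ⨅ p ∈ nearKernel V xe,
    ∫⁻ x in Iio xe, ENNReal.ofReal (energyDensity V (fun t y => φ t y - p t y) 0 x)

/-- The one-ended NEAR energy at time `t` below the receding edge `xe − |t|`
(companion of `ReggeWheeler.farEnergy`). -/
def nearEnergy (xe : ℝ) (φ : ℝ → ℝ → ℝ) (t : ℝ) : ℝ≥0∞ :=
  ∫⁻ x in {x : ℝ | x < xe - |t|}, ENNReal.ofReal (energyDensity V φ t x)

/-- The NEAR channel energy `liminf_l nearEnergy` (companion of `ReggeWheeler.farChannelEnergy`). -/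
def nearChannelEnergy (xe : ℝ) (φ : ℝ → ℝ → ℝ) (l : Filter ℝ) : ℝ≥0∞ :=
  liminf (nearEnergy V xe φ) l

/-- The one-ended FAR channel-of-energy inequality at the edge `xe` with constant `c`:
for every GLOBAL `C²` solution, `c · farDeficit ≤ E⁺_far + E⁻_far`. -/
def FarChannelInequality (xe c : ℝ) : Prop :=
  ∀ φ : ℝ → ℝ → ℝ, IsSolution V φ →
    ENNReal.ofReal c * farDeficit V xe φ ≤ farChannelEnergy V xe φ atTop + farChannelEnergy V xe φ atBot

/-- The one-ended NEAR channel-of-energy inequality at the edge `xe` with constant `c`. -/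
def NearChannelInequality (xe c : ℝ) : Prop :=
  ∀ φ : ℝ → ℝ → ℝ, IsSolution V φ →
    ENNReal.ofReal c * nearDeficit V xe φ ≤ nearChannelEnergy V xe φ atTop + nearChannelEnergy V xe φ atBot

end Vocabulary

/-- **The FAR log-edge half of K1R** (THE open content of the crux): K1R's quantifier block with
`ChannelInequality … xc ρ c` replaced by the one-ended far inequality at the edge `xc + ρ`. -/
def FarLogEdgeChannels : Prop :=
  ∀ M : ℝ, 0 < M → ∃ ρ₀ : ℝ, 0 ≤ ρ₀ ∧ ∃ C : ℝ, 0 ≤ C ∧ ∃ c : ℝ, 0 < c ∧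
    ∀ (r : ℝ → ℝ) (xc : ℝ), IsTortoiseRadius M r xc → ∀ (s ℓ : ℕ), s ≤ 2 → s ≤ ℓ →
      ∀ ρ : ℝ, ρ₀ + C * Real.log ((ℓ : ℝ) + 1) ≤ ρ →
        FarChannelInequality (linePotential M s ℓ r) (xc + ρ) c

/-- **The NEAR log-edge half of K1R**: the one-ended near inequality at the edge `xc − ρ`. -/
def NearLogEdgeChannels : Prop :=
  ∀ M : ℝ, 0 < M → ∃ ρ₀ : ℝ, 0 ≤ ρ₀ ∧ ∃ C : ℝ, 0 ≤ C ∧ ∃ c : ℝ, 0 < c ∧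
    ∀ (r : ℝ → ℝ) (xc : ℝ), IsTortoiseRadius M r xc → ∀ (s ℓ : ℕ), s ≤ 2 → s ≤ ℓ →
      ∀ ρ : ℝ, ρ₀ + C * Real.log ((ℓ : ℝ) + 1) ≤ ρ →
        NearChannelInequality (linePotential M s ℓ r) (xc - ρ) c

/-! ## The matched-edge model (the card's lever) -/

/-- The **impact function** `b(r) = r/√(1 − 2M/r)` (the flat radius whose centrifugal barrier
`ℓ(ℓ+1)/b²` equals `V_{1,ℓ}(r) = (1 − 2M/r)ℓ(ℓ+1)/r²` exactly). -/
def impact (M rr : ℝ) : ℝ := rr / Real.sqrt (1 - 2 * M / rr)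

/-- The **centrifugal model matched at the edge `X`** (tortoise coordinate): `ℓ(ℓ+1)/(y − X + b_X)²`,
`b_X = impact M (r X)` — the flat inverse-square potential centred at `a_X = X − b_X`, equal to
`V_{1,ℓ}` AT `y = X`.  On `y > a_X` its channel problem at the edge `X` is EXACTLY the flat one with
ball radius `b_X` (Côte–Laurent / KLLS identity, `c = 1`, kernel = the `ℓ+1` towers). -/
def matchedModel (M : ℝ) (ℓ : ℕ) (r : ℝ → ℝ) (X y : ℝ) : ℝ :=
  (ℓ : ℝ) * ((ℓ : ℝ) + 1) / (y - X + impact M (r X)) ^ 2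

/-- **Outer Born channels at scale `(Λ₀, a)`**: the one-ended far channel inequality with the
UNIFORM constant `1/2` for the whole Regge–Wheeler family at every edge beyond the Coulomb radius,
`r(xe) ≥ Λ₀ (ℓ+1)^a M` (a POLYNOMIAL ball — log-free but not a fixed ball; per mode it is the far
half of `FixedModeChannels`, stmt-10048, with `ρ₀(ℓ) = r⁻¹(Λ₀(ℓ+1)^a M)`). -/
def OuterBornChannels (Λ₀ a : ℝ) : Prop :=
  ∀ M : ℝ, 0 < M → ∀ (r : ℝ → ℝ) (xc : ℝ), IsTortoiseRadius M r xc → ∀ (s ℓ : ℕ), s ≤ 2 → s ≤ ℓ →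
    ∀ xe : ℝ, Λ₀ * ((ℓ : ℝ) + 1) ^ a * M ≤ r xe →
      FarChannelInequality (linePotential M s ℓ r) xe (1 / 2)

/-- Some admissible outer scale: `Λ₀ ≥ 6` and an exponent `a ∈ [1, 2]`. -/
def OuterBornSome : Prop :=
  ∃ Λ₀ : ℝ, 6 ≤ Λ₀ ∧ ∃ a : ℝ, 1 ≤ a ∧ a ≤ 2 ∧ OuterBornChannels Λ₀ a

/-- **Inner annulus channels with exponent `b`**: the far log-edge inequality RESTRICTED to solutions
whose Cauchy data are supported in the annulus `{x | xc + ρ < x ∧ r(x) < (ℓ+1)^b M}` between the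
log-edge and the polynomial radius (constants may depend on `b`). -/
def InnerAnnulusChannels (b : ℝ) : Prop :=
  ∀ M : ℝ, 0 < M → ∃ ρ₀ : ℝ, 0 ≤ ρ₀ ∧ ∃ C : ℝ, 0 ≤ C ∧ ∃ c : ℝ, 0 < c ∧
    ∀ (r : ℝ → ℝ) (xc : ℝ), IsTortoiseRadius M r xc → ∀ (s ℓ : ℕ), s ≤ 2 → s ≤ ℓ →
      ∀ ρ : ℝ, ρ₀ + C * Real.log ((ℓ : ℝ) + 1) ≤ ρ →
        ∀ ψ : ℝ → ℝ → ℝ, IsRWSolution M s ℓ r ψ →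
          CauchyDataSupportedOn ψ {x : ℝ | xc + ρ < x ∧ r x < ((ℓ : ℝ) + 1) ^ b * M} →
            ENNReal.ofReal c * farDeficit (linePotential M s ℓ r) (xc + ρ) ψ
              ≤ farChannelEnergy (linePotential M s ℓ r) (xc + ρ) ψ atTop
                + farChannelEnergy (linePotential M s ℓ r) (xc + ρ) ψ atBot

/-- The inner annulus inequality for every exponent `b ≥ 1`. -/
def InnerAnnulusAll : Prop :=
  ∀ b : ℝ, 1 ≤ b → InnerAnnulusChannels b

/-! ## The five stub STATEMENTS

Each stub statement is the `Prop` `Sig.stub_<name>`; the registered obligation is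
`theorem stub_<name> : Sig.stub_<name> := by sorry` below, and `UniformPhotonSphereChannelsR_of`
takes the five signatures as hypotheses BY NAME (skeleton audit: hypothesis heads = stub names). -/

/-- **Stub 1 — `stub_nearLogEdge`: the NEAR log-edge half, uniformly** (size M; common ground of all
six cards, TRIAGE r1-1 "Common note", r1-2 (a), r1-3 header).  `NearLogEdgeChannels` with the
witnesses `C = 4M`, `c = 1/4`, `ρ₀ = ρ₀′(M)`: VERBATIM the proof of the landed per-mode theorem
`Theorems.nearHalfLineChannels` (PhotonSphereChannelsNearChannels.lean, p73389), whose explicit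
`ρ₀(M, ℓ) = max 0 (2M·log(25600 M² B e^{3/(2M)}))`, `B = (ℓ(ℓ+1)+1)/(2M)³·e^{(r*(3M)−2M)/(2M)}`
satisfies `ρ₀(M, ℓ) ≤ ρ₀′(M) + 2M log(ℓ²+ℓ+1) ≤ ρ₀′(M) + 4M log(ℓ+1)`; so `ρ ≥ ρ₀′ + 4M log(ℓ+1)`
implies the per-mode hypothesis `ρ ≥ ρ₀(M, ℓ)` and the per-mode conclusion is, after unfolding
`NearChannelInequality`/`nearDeficit`/`nearKernel`/`nearChannelEnergy`/`nearEnergy`/`energyDensity`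
and `isTortoiseRadius_iff`, literally the inlined near statement (`Iio (xc − ρ)` = `{x | x < xc − ρ}`
definitionally).  Why it might fail: only by a bookkeeping slip — the constants are in the landed
proof.  Uses the load-bearing `C > 0` of the Disproof (this is where `C ≥ 4M` enters).
Leans on: `Theorems.nearHalfLineChannels` (its proof, not its statement), `rwTailConst_pos`,
`near_smallness`, `rwPotential_tortoise_le_const_mul_exp`, `Literature.Analysis.PDE.Wave1DNearChannelForward`. -/
def Sig.stub_nearLogEdge : Prop :=
  NearLogEdgeChannels

/-- **Stub 2 — `stub_matchedEdgeBorn`: the matched-edge tail and its zero-energy Born integral**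
(size M; the card's First lemma, constants doubled).  For a tortoise radius function, every `ℓ` and
every edge `X` with `r(X) ≥ 6M`: (i) TAIL — for `y ≥ X`,
`|V_{1,ℓ}(y) − ℓ(ℓ+1)/(y − X + b_X)²| ≤ 8 M ℓ(ℓ+1) (1 + log(r_y/r_X)) / r_y³` (the Coulomb logarithm
RESTARTS at the edge: `log(r_y/r_X)`, not `log(r_y/M)`; no `log ℓ`); (ii) BORN — the zero-energy
Born integral with the weight `y − a_X = y − X + b_X` (= the `(2ℓ+1)`-normalised centrifugal Green's
function bound, valid above and below the turning point) is finite and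
`∫_{y>X} (y − X + b_X)|V_{1,ℓ} − model| dy ≤ 12 M ℓ(ℓ+1)/r_X`, i.e. Born parameter
`(2ℓ+1)⁻¹ ∫ ≤ 6Mℓ/r_X`: small iff the edge lies beyond the Coulomb radius `r_X ≫ ℓ M`.
(`V_{1,ℓ} = linePotential M 1 ℓ r` is the pure centrifugal part `(1 − 2M/r)ℓ(ℓ+1)/r² = ℓ(ℓ+1)/b(r)²`;
the spin term `(1 − s²)(1 − 2M/r)2M/r³` of `s = 0, 2` is `≤ 6M/r³` and is added inside stub 3.)
Proof sketch (by hand, this seat): with `b = impact M ∘ r`, `db/dx = (r − 3M)/√(r(r − 2M))`,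
`β := 1 − db/dx ∈ (0, 2.33 M/r]` on `r ≥ 6M`, `D(y) := (y − X + b_X) − b(r_y) = ∫_X^y β ≥ 0`,
`δV = ℓ(ℓ+1)[b⁻² − (b + D)⁻²] = ℓ(ℓ+1) D(2b + D)/(b²(b + D)²) ∈ [0, 2ℓ(ℓ+1)D/b³]`, `b ≥ r`,
`D ≤ 2.33·(3/2) M log(r_y/r_X)` (`dy = dr/(1 − 2M/r) ≤ (3/2)dr`), whence (i) with `7 log ≤ 8(1 + log)`
and (ii) from `∫ (b + D)δV ≤ 2ℓ(ℓ+1)∫ D/b² dy ≤ 10.5 Mℓ(ℓ+1)∫_{r_X}^∞ log(r/r_X) dr/r² = 10.5 Mℓ(ℓ+1)/r_X`.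
Numerics (ℓ-free ratios, `calc/matched_edge_check.py`; r1-1 j013241 C; r1-2 E5): sup of
`|δV| r_y³/(Mℓ(ℓ+1)(1 + log(r_y/r_X)))` = 3.80–3.90 at `r_X = 6M`, decreasing; Born `≤ 4.98 Mℓ(ℓ+1)/r_X`.
Why it might fail: it cannot numerically; a formal slip in the tortoise calculus at worst changes
the constants (then restate with the proved ones — only `Λ₀` of stub 3 moves).
Leans on: `IsTortoiseRadius.{hasDerivAt, tortoiseCoord_eq, two_mul_lt, strictMono}`, `tortoiseCoord`,
`rwPotential_one`, `Real.log_le_sub_one_of_pos`, `MeasureTheory.integral_Ioi_of_hasDerivAt_of_tendsto`. -/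
def Sig.stub_matchedEdgeBorn : Prop :=
  ∀ (M : ℝ) (r : ℝ → ℝ) (xc : ℝ), IsTortoiseRadius M r xc → ∀ (ℓ : ℕ) (X : ℝ), 6 * M ≤ r X →
    (∀ y : ℝ, X ≤ y →
      |linePotential M 1 ℓ r y - matchedModel M ℓ r X y|
        ≤ 8 * M * ((ℓ : ℝ) * ((ℓ : ℝ) + 1)) * (1 + Real.log (r y / r X)) / r y ^ 3) ∧
    IntegrableOn (fun y => (y - X + impact M (r X)) * |linePotential M 1 ℓ r y - matchedModel M ℓ r X y|)
      (Ioi X) ∧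
    (∫ y in Ioi X, (y - X + impact M (r X)) * |linePotential M 1 ℓ r y - matchedModel M ℓ r X y|)
      ≤ 12 * M * ((ℓ : ℝ) * ((ℓ : ℝ) + 1)) / r X

/-- **Stub 3 — `stub_outerBorn`: the OUTER RUNG — Born-small edges give uniform far channels with
`c = 1/2`** (size L as mathematics, XL as a formalisation; THE LEVER of the card; TRIAGE r1-2/r1-3:
"a genuinely provable ℓ-uniform rung … worth landing whatever line is picked").  From the matched-edge
bounds (stub 2, by name): `∃ Λ₀ ≥ 6, ∃ a ∈ [1, 2]`, such that for EVERY `M, r, s ≤ 2, ℓ ≥ s` and every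
edge `xe` with `r(xe) ≥ Λ₀(ℓ+1)^a M`, `FarChannelInequality (linePotential M s ℓ r) xe (1/2)`.
Intended proof.  (0) Domain of dependence: the far cone `{x > xe + |t|}` never sees `V` on `x < xe`
(`wave1D_farEnergy_mono_of_nonneg` & co.; `Theorems.PhotonSphereChannelsFiniteSpeed`), so replace the
dynamics by the half-line problem on `(a_X, ∞)`, `a_X = xe − b_X`, with potential
`W = model + δV·1_{y ≥ xe}` (`model = ℓ(ℓ+1)/(y − a_X)²`, Dirichlet at `a_X`): same far energies, same
far kernel restricted to the cone.  (1) FLAT ANCHOR: for `model` the far inequality at the edge `xe`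
is the exact identity `E⁺ + E⁻ = ‖π^⊥ d‖²_{(2ℓ+3)-dim} ≥ dist²_{1D}(d, towers)` with ball radius
`b_X` (Côte–Laurent, doi:10.4171/rmi/1399 Thm 1.7 = arXiv:2109.08434; radial case KLLS
doi:10.1016/j.aim.2015.08.014 Thm 2/5, vendored 1-D form
`Literature.Analysis.PDE.InverseSquareChannelIdentity(.Reversed)` + `Literature.Analysis.ODE.InverseSquareLadder*`;
the 1-D energy differs from the `(2ℓ+3)`-dim one by the edge term `(ℓ+1)φ(xe)²/b_X ≥ 0`, which only
helps).  (2) BORN PERTURBATION, uniformly in `ℓ` and in `ω ∈ [0, ∞)`: with the zero-energy Born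
parameter `ε := (2ℓ+1)⁻¹∫_{xe}^∞ (y − a_X)|δV| ≤ (12ℓ(ℓ+1) + 13)M/((2ℓ+1) r_X) ≤ 7M(ℓ+1)/r_X ≤ 7/Λ₀`
(stub 2 + the spin term), the Jost solutions / translation representations `F_±^W` are
`O(ε)`-close to `F_±^{model}` in operator norm on the energy space (Volterra series with the
majorant `|G₀(y,y′)u⁰(y′)/u⁰(y)| ≤ (y′ − a_X)/(2ℓ+1)` for the centrifugal Green's function — the
weight of stub 2), hence the quadratic forms `E^±` move by `O(ε)`; the finite-energy tower subspace
`T_W` (span of the recessive Jordan chain, `ℓ+1` vectors) is `O(ℓ^{a−1}… )`-close to `T_model` —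
the exponent `a` absorbs the two known losses: `a = 4/3` for the Airy layer of the glancing Green's
function at the turning point (r1-2; r1-3 finds it harmless, `O(Mν^{2/3}/r_X)`), `a = 2` for the
accumulation `O(j·ε)`, `j ≤ ⌈ℓ/2⌉`, along the Jordan chain.  (3) Normalise by kernel invariance
(`E^±(d − k) = E^±(d)`, `k ∈ T_W`: finite-energy towers radiate nothing; `√E^±` is a seminorm) to
`‖d‖² ≤ 2 dist²(d, T_W)`, and conclude `E⁺ + E⁻ ≥ (1 − O(ε) − O(gap))·dist² ≥ ½ dist²` for `Λ₀` large;
the infimum over the FULL `farKernel` (all t-polynomial solutions on the cone) is `≤` the infimum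
over `T_W ⊆ farKernel`, which is the direction needed.  Infinite-energy data: both sides `= ⊤`
(flux bookkeeping, `Theorems.PhotonSphereChannelsChannelBounds`/`…FluxBookkeeping` pattern).
Why it might fail: the tower-subspace perturbation is NOT uniformly `O(ε)` even at `a = 2`
(ill-conditioned Müntz basis — but only the SUBSPACE matters, and at `r_X ≥ Λ₀(ℓ+1)²M` every chain
vector is individually `O(1/Λ₀)`-perturbed); or `c = 1/2` fails for small `ℓ` at moderate `Λ₀`
(then enlarge `Λ₀`: per mode the constant tends to the flat `1`).  Cheapest falsifier (card): far
numerics with exact kernel projection at `r_X = Λ ℓ M`, `Λ ∈ {1/4, 1, 4, 16}`, `ℓ ∈ {16, 64, 256}`: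
dies if `inf_d q` is not `≥ 1 − κ/Λ` uniformly in `ℓ`.  At fixed `ℓ` this stub IS the open far half
of `FixedModeChannels` (stmt-10048; prover seat 2 works it per mode by flat Duhamel) — land it there too.
Leans on: stub 2 (by name), `InverseSquareChannelIdentity(.Reversed)`, `InverseSquareLadder{,Asymptotics,
Expansion,Coercivity,Preimage}`, `RecessiveSolution.exists_recessive`, `Wave1D{ExteriorEnergy,
FarEnergyLimits,FluxBookkeeping,TrapezoidEnergy}`, `BlindnessWavePicard.exists_picard_fixedPoint`
(Cauchy theory pattern), Mathlib `Mathlib.Analysis.ODE.Gronwall` (Volterra bounds). -/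
def Sig.stub_outerBorn : Prop :=
  Sig.stub_matchedEdgeBorn → OuterBornSome

/-- **Stub 4 — `stub_innerAnnulus`: the INNER ANNULUS — far log-edge channels for data supported
between the log-edge and the polynomial radius** (size XL; HARDEST; honestly "the crux restricted",
TRIAGE r1-2: "keeps essentially all of the difficulty (the edge-hugging tangential states live
there), with genuine simplifications").  For every exponent `b ≥ 1`: `∀ M > 0 ∃ ρ₀(b,M) C(b,M) ≥ 0,
c(b,M) > 0` such that for every tortoise radius function, `s ≤ 2 ≤ …`, `ℓ ≥ s`, `ρ ≥ ρ₀ + C log(ℓ+1)`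
and every global RW solution `ψ` whose Cauchy data vanish off `{x | xc + ρ < x ∧ r(x) < (ℓ+1)^b M}`:
`c · farDeficit ≤ E⁺_far + E⁻_far` at the edge `xc + ρ`.  What the restriction buys (card (4)):
a FREQUENCY FLOOR — the conserved distorted-spectral measure of such data below
`ω₁ = (1 − η)√V(X₁)`, `r(X₁) = (ℓ+1)^b M`, is exponentially small (tunnelling through `(X₁, x_t(ω))`),
so no threshold / zero-energy analysis and no tail control are needed; a CLOCK — every ray of the
data is decided (lost both ways or caught) within `|t| ≤ 4X₁`, with window margin
`≥ (C − 2M b) log ℓ − O(M) → ∞`; a COMPACT RANGE OF SCALES — `b log ℓ − log(C log ℓ)` e-folds with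
total scale-invariant deformation `∫(δV/V)dx/x ≈ 4M(1 + log x_f)/x_f → 0`; beyond `X₁` the
potential may again be replaced by the matched model up to Born error `O(ℓ^{1−b})` (stub 2).  This
is where a sibling lever does the work: peel-then-wedge (cards `crum-peeling-recessive-tower` +
`wedge-identity-null-hardy`: after `ℓ` recessive Darboux rungs the residual `Q_ℓ` is a translate of a
FIXED profile, `Q_ℓ(2M ln ℓ + δ) → q_∞(δ)`, r1-2 E3, and null-ray Hardy closes iff
`8 sup_t t²Q_ℓ(x_f + t) < 1`, measured `0.885–0.93` at `x_f = 2.6 + 2 ln ℓ`), or mirror–Nehari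
(card `mirror-nehari-blaschke`: `c_far = 1 − cos θ_F`, `cos θ_F ≈ 0.27/Y`, `Y = (x_f − 2M ln ℓ)/2M`).
Expected constants: `C(b) > 2M·b`-ish (regime overlap `ℓ^{C/2M} ≫ ℓ^b`), `c` close to `1`.
Why it might fail: exactly the crux's why-might-fail (edge-hugging tangential packets at
`x_f ~ C ln ℓ` must be absorbed by the ill-conditioned tower kernel non-perturbatively) — if it fails
for EVERY `C` at some `b ≤ 3`, the far half of K1R is false for every `C` and the route's kill
criterion fires (far-side numerics of the Disproof, findings 3–4, and three independent threshold
determinations `C_far = 2M` say it holds).  NOT an instance refuted by `frozen_packet_far`: the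
kernel is kept.  Support hypothesis in the vocabulary's `CauchyDataSupportedOn` (data vanish OFF the
set); the empty-annulus case is the zero solution (harmless).
Leans on: everything of stubs 2–3, plus `Literature.Analysis.PDE.Wave1DIntertwining` / `InverseSquareLadder*`
(peeling), `Theorems.PhotonSphereChannelsFarKernelEnergy`, `RW.exteriorEnergy_antitoneOn_rw`,
`RW.eq_zero_of_cauchyDataSupportedOn_rw`, `RW.totalEnergy_eq_rw`. -/
def Sig.stub_innerAnnulus : Prop :=
  InnerAnnulusAll

/-- **Stub 5 — `stub_farGluing`: the card's TRANSFER — outer rung ∧ inner annulus ⇒ the far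
log-edge half** (size L; the frame's own lemma; TRIAGE r1-2/r1-3: "separately falsifiable gluing …
cross-term estimate unverified").  Given `OuterBornChannels Λ₀ a` (some `Λ₀ ≥ 6`, `a ∈ [1,2]`) and
`InnerAnnulusChannels b` for all `b ≥ 1`, conclude `FarLogEdgeChannels` with
`C′ = max(C(b), 2M(a + 3δ))`, `c′ = (1 − o(1))·min(c(b), 1/2)/2`, `b = a + 3δ`.  Intended proof, per
time-reversal parity (the far channel form splits into even ⊕ odd): WLOG finite far energy
(else both sides `⊤`); normalise `‖d‖² ≤ 2 dist²(d, K)` by KERNEL INVARIANCE (`E^±(d − k) = E^±(d)`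
for finite-energy `k` in the far kernel: towers radiate nothing, `√E^±` is a seminorm; and
`dist(d − k, K) = dist(d, K)`); choose the cut `R* ∈ [(ℓ+1)^{a+δ}M, (ℓ+1)^{a+2δ}M]` (in `r`) among
`δ log₂ ℓ` dyadic candidates so that the shell `(R*/2, 2R*)` carries `≤ E/(δ log₂ ℓ)` of the energy
(pigeonhole); split the data smoothly there; OUTER piece: `E^±_{x_f} ≥ E^±_{R*}` (monotonicity of far
energies in the edge, `wave1D_farEnergy_mono_*`) and stub 3 at the edge `R*` (`r(R*) ≥ Λ₀(ℓ+1)^a M`);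
INNER piece: supported in `(x_f, 2R*) ⊆ {r < (ℓ+1)^b M}`, stub 4; CROSS TERMS of the early-profile
form: directly outgoing outer radiation sits at `u ≲ −R*`, bounced outer components are late
(`u > 0`), and the one dangerous family — tangential states on both sides of the cut with the same
emission window `u ∈ (−2R*, 0)` — has frequency ratio bounded away from `1` except inside the shell,
so non-stationary phase (`O(1/ℓ)`, envelopes varying on scale `R* ≫ R*/ℓ`) plus the shell bound
give `|cross| ≤ (κ/(δ log ℓ) + O(ℓ^{−δ/2}))‖d‖² = o(1)·dist²`.  Small `ℓ` (`ℓ ≤ ℓ₀(δ)`): absorbed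
into `ρ₀` — for `ρ ≥ ρ₀` large the edge itself satisfies `r(xc + ρ) ≥ Λ₀(ℓ₀+1)^a M` and stub 3
applies directly (no gluing).  Why it might fail: the cross-term bound — inner and outer tangential
families straddling the cut may correlate at leading order (then the pigeonhole shell must be
widened to a `log`-fraction of scales, costing `c′ ∼ 1/log ℓ`: fatal for uniformity); or kernel
invariance needs the far census "finite-energy zero-radiation far solutions are towers" in the
direction `E^±(k) = 0` only (true for t-polynomial finite-energy solutions).  Cheapest falsifier
(card, second test): at `x_f = 4 log(ℓ+1)`, `q` for an inner datum alone vs inner datum + outer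
tangential packet at `(ℓ+1)^{a+δ}M`: dies if the combined `q` drops below `min − O(1/log ℓ)`.
Leans on: stubs 3–4 (by name), `wave1D_farEnergy_mono_of_nonneg/_nonpos`,
`Theorems.PhotonSphereChannelsFarKernelEnergy` (tower energies), `RW.totalEnergy_eq_rw`,
`FrozenPacket.far_energy_le_at` (the imported Negative lemma's engine, reused positively for
"bounced components are late"), smooth cutoffs (`ContDiffBump`). -/
def Sig.stub_farGluing : Prop :=
  OuterBornSome → InnerAnnulusAll → FarLogEdgeChannels

/-! ## Registered stubs (the ONLY sorries of this file) -/

/-- Stub 1 (M, near restatement with `C = 4M`, `c = 1/4`; see `Sig.stub_nearLogEdge`). -/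
theorem stub_nearLogEdge : Sig.stub_nearLogEdge := by
  sorry

/-- Stub 2 (M, matched-edge tail + Born integral; see `Sig.stub_matchedEdgeBorn`). -/
theorem stub_matchedEdgeBorn : Sig.stub_matchedEdgeBorn := by
  sorry

/-- Stub 3 (L/XL, THE LEVER: outer Born rung, `c = 1/2`; see `Sig.stub_outerBorn`). -/
theorem stub_outerBorn : Sig.stub_outerBorn := by
  sorry

/-- Stub 4 (XL, HARDEST: inner annulus channels; see `Sig.stub_innerAnnulus`). -/
theorem stub_innerAnnulus : Sig.stub_innerAnnulus := by
  sorry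

/-- Stub 5 (L, the Transfer / gluing; see `Sig.stub_farGluing`). -/
theorem stub_farGluing : Sig.stub_farGluing := by
  sorry

/-! ## PROVED: the two-ended decoupling (uniform version of `Theorems.fixedModeChannels_of_near_far`)

The exterior region `{ρ + |t| < |x − xc|}` is the disjoint union of the far component
`{xc + ρ + |t| < x}` and the near component `{x < xc − ρ − |t|}`; the exterior cone and the
t-polynomial kernel split accordingly (a kernel element of the two-component cone is GLUED from a
far and a near one: `p = if x ≤ xc then p_near else p_far` is `C²`, a solution and t-polynomial on
each open component — derivatives are local), so `kernelDeficit ≤ farDeficit + nearDeficit`; the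
exterior energy is `farEnergy + nearEnergy`, each non-increasing in `|t|` by finite speed of
propagation, so `liminf far + liminf near ≤ liminf exterior` at `±∞`. -/

/-- **Decoupling at one aperture.**  For a continuous potential `V ≥ 0`, `ρ ≥ 0`: the near
inequality at the edge `xc − ρ` with constant `cn` and the far inequality at the edge `xc + ρ` with
constant `cf` imply the two-ended `ChannelInequality V xc ρ (min cn cf)`. -/
theorem channelInequality_of_near_far {V : ℝ → ℝ} (hVc : Continuous V) (hV0 : ∀ x, 0 ≤ V x)
    {xc ρ cn cf : ℝ} (hρ0 : 0 ≤ ρ)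
    (hN : NearChannelInequality V (xc - ρ) cn) (hF : FarChannelInequality V (xc + ρ) cf) :
    ChannelInequality V xc ρ (min cn cf) := by
  intro ψ hψ
  have hψ2 : ContDiff ℝ 2 (Function.uncurry ψ) := hψ.1
  have hsol' : ∀ t x, iteratedDeriv 2 (fun τ => ψ τ x) t - iteratedDeriv 2 (ψ t) x + V x * ψ t x = 0 :=
    fun t x => hψ.2 (t, x)
  have HF := hF ψ hψ
  have HN := hN ψ hψ
  -- (A) monotonicity of the one-sided energies (finite speed of propagation)
  have hEf_anti : AntitoneOn (farEnergy V (xc + ρ) ψ) (Ici 0) := fun a ha b _ hab =>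
    wave1D_farEnergy_mono_of_nonneg hVc hV0 hψ2 hsol' (xc + ρ) ha hab
  have hEf_mono : MonotoneOn (farEnergy V (xc + ρ) ψ) (Iic 0) := fun a _ b hb hab =>
    wave1D_farEnergy_mono_of_nonpos hVc hV0 hψ2 hsol' (xc + ρ) hb hab
  have hEn_anti : AntitoneOn (nearEnergy V (xc - ρ) ψ) (Ici 0) := fun a ha b _ hab =>
    wave1D_nearEnergy_mono_of_nonneg hVc hV0 hψ2 hsol' (xc - ρ) ha hab
  have hEn_mono : MonotoneOn (nearEnergy V (xc - ρ) ψ) (Iic 0) := fun a _ b hb hab =>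
    wave1D_nearEnergy_mono_of_nonpos hVc hV0 hψ2 hsol' (xc - ρ) hb hab
  -- (B) the exterior region splits into the two components
  have hsplit : ∀ u : ℝ, 0 ≤ u → {x : ℝ | u < |x - xc|} = Ioi (xc + u) ∪ Iio (xc - u) := by
    intro u hu
    ext x
    simp only [mem_setOf_eq, mem_union, mem_Ioi, mem_Iio]
    constructor
    · intro h
      rcases le_or_gt 0 (x - xc) with hx | hx
      · rw [abs_of_nonneg hx] at h; left; linarith
      · rw [abs_of_neg hx] at h; right; linarith
    · rintro (h | h)
      · exact lt_of_lt_of_le (by linarith) (le_abs_self _)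
      · exact lt_of_lt_of_le (by linarith) (neg_le_abs _)
  have hdisj : ∀ u : ℝ, 0 ≤ u → Disjoint (Ioi (xc + u)) (Iio (xc - u)) := fun u hu =>
    Set.disjoint_left.2 fun x hx hx' => by
      simp only [mem_Ioi, mem_Iio] at hx hx'; linarith
  have hEext : exteriorEnergy V xc ρ ψ = fun t => farEnergy V (xc + ρ) ψ t + nearEnergy V (xc - ρ) ψ t := by
    funext t
    have hu : 0 ≤ ρ + |t| := add_nonneg hρ0 (abs_nonneg t)
    show (∫⁻ x in {x : ℝ | ρ + |t| < |x - xc|}, ENNReal.ofReal (energyDensity V ψ t x))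
        = (∫⁻ x in Ioi (xc + ρ + |t|), ENNReal.ofReal (energyDensity V ψ t x))
          + ∫⁻ x in Iio (xc - ρ - |t|), ENNReal.ofReal (energyDensity V ψ t x)
    rw [hsplit _ hu, lintegral_union measurableSet_Iio (hdisj _ hu), add_assoc, sub_sub]
  have htop : farChannelEnergy V (xc + ρ) ψ atTop + nearChannelEnergy V (xc - ρ) ψ atTop
      ≤ channelEnergy V xc ρ ψ atTop := by
    show liminf (farEnergy V (xc + ρ) ψ) atTop + liminf (nearEnergy V (xc - ρ) ψ) atTop
        ≤ liminf (exteriorEnergy V xc ρ ψ) atTop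
    rw [hEext]
    exact add_liminf_le_liminf_add_of_antitoneOn hEf_anti hEn_anti
  have hbot : farChannelEnergy V (xc + ρ) ψ atBot + nearChannelEnergy V (xc - ρ) ψ atBot
      ≤ channelEnergy V xc ρ ψ atBot := by
    show liminf (farEnergy V (xc + ρ) ψ) atBot + liminf (nearEnergy V (xc - ρ) ψ) atBot
        ≤ liminf (exteriorEnergy V xc ρ ψ) atBot
    rw [hEext]
    exact add_liminf_le_liminf_add_of_monotoneOn hEf_mono hEn_mono
  -- (C) the kernel is a product: glueing one-sided kernel elements
  set If : (ℝ → ℝ → ℝ) → ℝ≥0∞ := fun p =>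
    ∫⁻ x in Ioi (xc + ρ), ENNReal.ofReal (energyDensity V (fun t y => ψ t y - p t y) 0 x) with hIf
  set In : (ℝ → ℝ → ℝ) → ℝ≥0∞ := fun p =>
    ∫⁻ x in Iio (xc - ρ), ENNReal.ofReal (energyDensity V (fun t y => ψ t y - p t y) 0 x) with hIn
  set I : (ℝ → ℝ → ℝ) → ℝ≥0∞ := fun p =>
    ∫⁻ x in {x : ℝ | ρ < |x - xc|}, ENNReal.ofReal (energyDensity V (fun t y => ψ t y - p t y) 0 x)
    with hI
  have hfar_of_mem : ∀ z : ℝ × ℝ, z ∈ exteriorCone xc ρ → z ∈ farCone (xc + ρ) ∨ z ∈ nearCone (xc - ρ) := by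
    intro z hz
    have hz' : ρ + |z.1| < |z.2 - xc| := hz
    rcases le_or_gt 0 (z.2 - xc) with h | h
    · left; rw [abs_of_nonneg h] at hz'; show xc + ρ + |z.1| < z.2; linarith
    · right; rw [abs_of_neg h] at hz'; show z.2 < xc - ρ - |z.1|; linarith
  have key : kernelDeficit V xc ρ ψ ≤ farDeficit V (xc + ρ) ψ + nearDeficit V (xc - ρ) ψ := by
    show (⨅ p ∈ rwKernel V xc ρ, I p) ≤ (⨅ p ∈ farKernel V (xc + ρ), If p) + (⨅ p ∈ nearKernel V (xc - ρ), In p)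
    simp_rw [ENNReal.iInf_add, ENNReal.add_iInf]
    refine le_iInf fun pf => le_iInf fun hpf => le_iInf fun pn => le_iInf fun hpn => ?_
    obtain ⟨hpf1, hpf2, Nf, af, hpf3⟩ := hpf
    obtain ⟨hpn1, hpn2, Nn, an, hpn3⟩ := hpn
    set g : ℝ → ℝ → ℝ := fun t x => if x ≤ xc then pn t x else pf t x with hg
    -- local agreement of the glued function with the pieces
    have hg_far : ∀ x, xc < x → ∀ t, g t x = pf t x := fun x hx t => by
      simp only [hg, if_neg (not_le.2 hx)]
    have hg_near : ∀ x, x < xc → ∀ t, g t x = pn t x := fun x hx t => by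
      simp only [hg, if_pos hx.le]
    have hg_far_ev : ∀ t x, xc < x → (g t) =ᶠ[𝓝 x] (pf t) := fun t x hx =>
      (eventually_gt_nhds hx).mono fun y hy => hg_far y hy t
    have hg_near_ev : ∀ t x, x < xc → (g t) =ᶠ[𝓝 x] (pn t) := fun t x hx =>
      (eventually_lt_nhds hx).mono fun y hy => hg_near y hy t
    have hxfar : ∀ z : ℝ × ℝ, z ∈ farCone (xc + ρ) → xc < z.2 := fun z hz => by
      have h : xc + ρ + |z.1| < z.2 := hz
      linarith [abs_nonneg z.1]
    have hxnear : ∀ z : ℝ × ℝ, z ∈ nearCone (xc - ρ) → z.2 < xc := fun z hz => by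
      have h : z.2 < xc - ρ - |z.1| := hz
      linarith [abs_nonneg z.1]
    have hgP : g ∈ rwKernel V xc ρ := by
      refine ⟨?_, ?_, ?_⟩
      · -- C² on the two-component cone
        intro z hz
        rcases hfar_of_mem z hz with hzf | hzn
        · have h1 : ContDiffAt ℝ 2 (Function.uncurry pf) z :=
            hpf1.contDiffAt ((isOpen_farCone (xc + ρ)).mem_nhds hzf)
          have h2 : Function.uncurry g =ᶠ[𝓝 z] Function.uncurry pf := by
            have : ∀ᶠ w : ℝ × ℝ in 𝓝 z, xc < w.2 :=
              (isOpen_lt continuous_const continuous_snd).mem_nhds (hxfar z hzf)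
            exact this.mono fun w hw => hg_far w.2 hw w.1
          exact (h1.congr_of_eventuallyEq h2).contDiffWithinAt
        · have h1 : ContDiffAt ℝ 2 (Function.uncurry pn) z :=
            hpn1.contDiffAt ((isOpen_nearCone (xc - ρ)).mem_nhds hzn)
          have h2 : Function.uncurry g =ᶠ[𝓝 z] Function.uncurry pn := by
            have : ∀ᶠ w : ℝ × ℝ in 𝓝 z, w.2 < xc :=
              (isOpen_lt continuous_snd continuous_const).mem_nhds (hxnear z hzn)
            exact this.mono fun w hw => hg_near w.2 hw w.1
          exact (h1.congr_of_eventuallyEq h2).contDiffWithinAt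
      · -- a solution on the cone
        intro z hz
        rcases hfar_of_mem z hz with hzf | hzn
        · have hsolf : iteratedDeriv 2 (fun τ => pf τ z.2) z.1 - iteratedDeriv 2 (pf z.1) z.2
              + V z.2 * pf z.1 z.2 = 0 := hpf2 z hzf
          show iteratedDeriv 2 (fun τ => g τ z.2) z.1 - iteratedDeriv 2 (g z.1) z.2
              + V z.2 * g z.1 z.2 = 0
          have e1 : (fun τ => g τ z.2) = fun τ => pf τ z.2 := funext (hg_far z.2 (hxfar z hzf))
          rw [e1, (hg_far_ev z.1 z.2 (hxfar z hzf)).iteratedDeriv_eq, hg_far z.2 (hxfar z hzf)]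
          exact hsolf
        · have hsoln : iteratedDeriv 2 (fun τ => pn τ z.2) z.1 - iteratedDeriv 2 (pn z.1) z.2
              + V z.2 * pn z.1 z.2 = 0 := hpn2 z hzn
          show iteratedDeriv 2 (fun τ => g τ z.2) z.1 - iteratedDeriv 2 (g z.1) z.2
              + V z.2 * g z.1 z.2 = 0
          have e1 : (fun τ => g τ z.2) = fun τ => pn τ z.2 := funext (hg_near z.2 (hxnear z hzn))
          rw [e1, (hg_near_ev z.1 z.2 (hxnear z hzn)).iteratedDeriv_eq, hg_near z.2 (hxnear z hzn)]
          exact hsoln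
      · -- polynomial in `t` on the cone
        refine ⟨Nf + Nn, fun i x => if x ≤ xc then (if i < Nn then an i x else 0)
          else (if i < Nf then af i x else 0), ?_⟩
        intro z hz
        rcases hfar_of_mem z hz with hzf | hzn
        · have hx := hxfar z hzf
          calc g z.1 z.2 = pf z.1 z.2 := hg_far z.2 hx z.1
            _ = ∑ i ∈ Finset.range Nf, af i z.2 * z.1 ^ i := hpf3 z hzf
            _ = ∑ i ∈ Finset.range Nf, (if i < Nf then af i z.2 else 0) * z.1 ^ i :=
                Finset.sum_congr rfl fun i hi => by rw [if_pos (Finset.mem_range.1 hi)]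
            _ = ∑ i ∈ Finset.range (Nf + Nn), (if i < Nf then af i z.2 else 0) * z.1 ^ i := by
                refine Finset.sum_subset (Finset.range_subset_range.2 (Nat.le_add_right _ _)) ?_
                intro i _ hi
                rw [if_neg (fun h => hi (Finset.mem_range.2 h)), zero_mul]
            _ = _ := Finset.sum_congr rfl fun i _ => by simp only [if_neg (not_le.2 hx)]
        · have hx := hxnear z hzn
          calc g z.1 z.2 = pn z.1 z.2 := hg_near z.2 hx z.1
            _ = ∑ i ∈ Finset.range Nn, an i z.2 * z.1 ^ i := hpn3 z hzn
            _ = ∑ i ∈ Finset.range Nn, (if i < Nn then an i z.2 else 0) * z.1 ^ i :=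
                Finset.sum_congr rfl fun i hi => by rw [if_pos (Finset.mem_range.1 hi)]
            _ = ∑ i ∈ Finset.range (Nf + Nn), (if i < Nn then an i z.2 else 0) * z.1 ^ i := by
                refine Finset.sum_subset (Finset.range_subset_range.2 (Nat.le_add_left _ _)) ?_
                intro i _ hi
                rw [if_neg (fun h => hi (Finset.mem_range.2 h)), zero_mul]
            _ = _ := Finset.sum_congr rfl fun i _ => by simp only [if_pos hx.le]
    -- the initial deviation energy of the glued element splits
    have hIg : I g = If pf + In pn := by
      have hfar_int : EqOn (fun x => ENNReal.ofReal (energyDensity V (fun t y => ψ t y - g t y) 0 x))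
          (fun x => ENNReal.ofReal (energyDensity V (fun t y => ψ t y - pf t y) 0 x)) (Ioi (xc + ρ)) := by
        intro x hx
        have hx' : xc < x := by have h : xc + ρ < x := hx; linarith
        show ENNReal.ofReal (deriv (fun τ => ψ τ x - g τ x) 0 ^ 2
            + deriv (fun y => ψ 0 y - g 0 y) x ^ 2 + V x * (ψ 0 x - g 0 x) ^ 2)
          = ENNReal.ofReal (deriv (fun τ => ψ τ x - pf τ x) 0 ^ 2
            + deriv (fun y => ψ 0 y - pf 0 y) x ^ 2 + V x * (ψ 0 x - pf 0 x) ^ 2)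
        have e1 : (fun τ => ψ τ x - g τ x) = fun τ => ψ τ x - pf τ x :=
          funext fun τ => by rw [hg_far x hx' τ]
        have e2 : (fun y => ψ 0 y - g 0 y) =ᶠ[𝓝 x] fun y => ψ 0 y - pf 0 y :=
          (hg_far_ev 0 x hx').mono fun y hy => by simp only [hy]
        rw [e1, e2.deriv_eq, hg_far x hx' 0]
      have hnear_int : EqOn (fun x => ENNReal.ofReal (energyDensity V (fun t y => ψ t y - g t y) 0 x))
          (fun x => ENNReal.ofReal (energyDensity V (fun t y => ψ t y - pn t y) 0 x)) (Iio (xc - ρ)) := by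
        intro x hx
        have hx' : x < xc := by have h : x < xc - ρ := hx; linarith
        show ENNReal.ofReal (deriv (fun τ => ψ τ x - g τ x) 0 ^ 2
            + deriv (fun y => ψ 0 y - g 0 y) x ^ 2 + V x * (ψ 0 x - g 0 x) ^ 2)
          = ENNReal.ofReal (deriv (fun τ => ψ τ x - pn τ x) 0 ^ 2
            + deriv (fun y => ψ 0 y - pn 0 y) x ^ 2 + V x * (ψ 0 x - pn 0 x) ^ 2)
        have e1 : (fun τ => ψ τ x - g τ x) = fun τ => ψ τ x - pn τ x :=
          funext fun τ => by rw [hg_near x hx' τ]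
        have e2 : (fun y => ψ 0 y - g 0 y) =ᶠ[𝓝 x] fun y => ψ 0 y - pn 0 y :=
          (hg_near_ev 0 x hx').mono fun y hy => by simp only [hy]
        rw [e1, e2.deriv_eq, hg_near x hx' 0]
      show (∫⁻ x in {x : ℝ | ρ < |x - xc|}, ENNReal.ofReal (energyDensity V (fun t y => ψ t y - g t y) 0 x))
        = If pf + In pn
      rw [hsplit ρ hρ0, lintegral_union measurableSet_Iio (hdisj ρ hρ0),
        setLIntegral_congr_fun measurableSet_Ioi hfar_int,
        setLIntegral_congr_fun measurableSet_Iio hnear_int]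
    calc (⨅ p ∈ rwKernel V xc ρ, I p) ≤ I g := biInf_le I hgP
      _ = If pf + In pn := hIg
  -- (D) assemble
  calc ENNReal.ofReal (min cn cf) * kernelDeficit V xc ρ ψ
      ≤ ENNReal.ofReal (min cn cf) * (farDeficit V (xc + ρ) ψ + nearDeficit V (xc - ρ) ψ) := by gcongr
    _ = ENNReal.ofReal (min cn cf) * farDeficit V (xc + ρ) ψ
        + ENNReal.ofReal (min cn cf) * nearDeficit V (xc - ρ) ψ := mul_add _ _ _
    _ ≤ ENNReal.ofReal cf * farDeficit V (xc + ρ) ψ + ENNReal.ofReal cn * nearDeficit V (xc - ρ) ψ := by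
        gcongr
        · exact min_le_right _ _
        · exact min_le_left _ _
    _ ≤ (farChannelEnergy V (xc + ρ) ψ atTop + farChannelEnergy V (xc + ρ) ψ atBot)
        + (nearChannelEnergy V (xc - ρ) ψ atTop + nearChannelEnergy V (xc - ρ) ψ atBot) := add_le_add HF HN
    _ = (farChannelEnergy V (xc + ρ) ψ atTop + nearChannelEnergy V (xc - ρ) ψ atTop)
        + (farChannelEnergy V (xc + ρ) ψ atBot + nearChannelEnergy V (xc - ρ) ψ atBot) :=
        add_add_add_comm _ _ _ _
    _ ≤ channelEnergy V xc ρ ψ atTop + channelEnergy V xc ρ ψ atBot := add_le_add htop hbot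

/-- **K1R from its two log-edge halves** (uniform constants: `ρ₀ = max`, `C = max`, `c = min`;
`log(ℓ+1) ≥ 0` makes the halves' edge hypotheses follow from K1R's). -/
theorem uniform_of_near_far (hN : NearLogEdgeChannels) (hF : FarLogEdgeChannels) :
    Summit.FinalStateConjecture.FinalStateConjecture.Theses.PhotonSphereChannels.UniformPhotonSphereChannelsR := by
  intro M hM
  obtain ⟨ρn, hρn, Cn, hCn, cn, hcn, HN⟩ := hN M hM
  obtain ⟨ρf, hρf, Cf, hCf, cf, hcf, HF⟩ := hF M hM
  refine ⟨max ρn ρf, hρn.trans (le_max_left _ _), max Cn Cf, hCn.trans (le_max_left _ _),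
    min cn cf, lt_min hcn hcf, ?_⟩
  intro r xc hr s ℓ hs hsℓ ρ hρ
  have hℓ0 : (0 : ℝ) ≤ ℓ := Nat.cast_nonneg ℓ
  have hlog : 0 ≤ Real.log ((ℓ : ℝ) + 1) := Real.log_nonneg (by linarith)
  have hCn' : Cn * Real.log ((ℓ : ℝ) + 1) ≤ max Cn Cf * Real.log ((ℓ : ℝ) + 1) :=
    mul_le_mul_of_nonneg_right (le_max_left _ _) hlog
  have hCf' : Cf * Real.log ((ℓ : ℝ) + 1) ≤ max Cn Cf * Real.log ((ℓ : ℝ) + 1) :=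
    mul_le_mul_of_nonneg_right (le_max_right _ _) hlog
  have hρn' : ρn + Cn * Real.log ((ℓ : ℝ) + 1) ≤ ρ := by linarith [le_max_left ρn ρf]
  have hρf' : ρf + Cf * Real.log ((ℓ : ℝ) + 1) ≤ ρ := by linarith [le_max_right ρn ρf]
  have hρ0 : 0 ≤ ρ := by
    have : 0 ≤ Cn * Real.log ((ℓ : ℝ) + 1) := mul_nonneg hCn hlog
    linarith
  have hVc : Continuous (linePotential M s ℓ r) :=
    continuous_linePotential s ℓ hr.continuous fun x => (hr.pos x).ne'
  have hV0 : ∀ x, 0 ≤ linePotential M s ℓ r x :=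
    linePotential_nonneg hr.mass_pos.le hsℓ hr.two_mul_lt
  exact channelInequality_of_near_far hVc hV0 hρ0 (HN r xc hr s ℓ hs hsℓ ρ hρn')
    (HF r xc hr s ℓ hs hsℓ ρ hρf')

/-! ## The composition: the five stubs conclude the crux BY NAME — real proof, no `sorry` -/

/-- **`UniformPhotonSphereChannelsR` from the five stubs.**  FAR half: the gluing (stub 5) of the
outer Born rung (stub 3, fed with the matched-edge bounds of stub 2) with the inner annulus
(stub 4); then the two-ended decoupling `uniform_of_near_far` with the near half (stub 1). -/
theorem UniformPhotonSphereChannelsR_of :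
    Sig.stub_nearLogEdge → Sig.stub_matchedEdgeBorn → Sig.stub_outerBorn → Sig.stub_innerAnnulus →
    Sig.stub_farGluing →
      Summit.FinalStateConjecture.FinalStateConjecture.Theses.PhotonSphereChannels.UniformPhotonSphereChannelsR :=
  fun hN hB hO hI hG => uniform_of_near_far hN (hG (hO hB) hI)

/-- The skeleton instantiated: the crux from the five registered stubs.  When the last stub lands
this is the crux proof. -/
theorem UniformPhotonSphereChannelsR_skeleton :
    Summit.FinalStateConjecture.FinalStateConjecture.Theses.PhotonSphereChannels.UniformPhotonSphereChannelsR :=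
  UniformPhotonSphereChannelsR_of stub_nearLogEdge stub_matchedEdgeBorn stub_outerBorn stub_innerAnnulus
    stub_farGluing

end Summit.FinalStateConjecture.FinalStateConjecture.Cruxes.UniformPhotonSphereChannelsR.MatchedEdgeBornTail

end
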